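import Summits.NavierStokesRegularity.NavierStokesRegularity.Theorems.AxisymmetricExtremalityAxisymmetricKatoGlobalStubSeregin2020TypeIILemma22DeGiorgiIsoperimetric
import Mathlib.MeasureTheory.Integral.IntervalIntegral.AbsolutelyContinuousFun
import Mathlib.Analysis.Calculus.Rademacher
import HarnessLib

/-!
# AxisTwistDoorAveragedConeLiouvilleNUIsoperimetricLip — De Giorgi's isoperimetric inequality on balls
# for LIPSCHITZ functions (tool (t2) of the N4/T1 Lipschitz ports, plan `pub/ns-inputs/kits/N4-T1-plan.md` §3)

The Lipschitz twin of the tree's `deGiorgi_isoperimetric_ball_fin_three`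
(`…Lemma22DeGiorgiIsoperimetric.lean`, `C¹` slices): for `w` Lipschitz on the open ball
`B(x₀, R) ⊆ ℝ³` and levels `k < l`,
`(l - k) · |B ∩ {w ≤ k}| · |B ∩ {l ≤ w}| ≤ (64π/3) R⁴ ∫_{B ∩ {k < w < l}} ‖Dw‖`,
SAME constant and SAME open band, with `fderiv ℝ w` the a.e. derivative (Rademacher).
Proof: the two-point/segment argument of Caffarelli–Vasseur's Lemma 1.4 exactly as in the tree's
`deGiorgi_levelSet_ineq_of_ae_segment`, with two changes: (a) the one-dimensional crossing lemma is
proved for ABSOLUTELY CONTINUOUS restrictions `t ↦ w(x + t(y − x))` (Mathlib's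
`LipschitzOnWith.absolutelyContinuousOnInterval`, `AbsolutelyContinuousOnInterval.integral_deriv_eq_sub`);
(b) the transported density is `H = 𝟙_{band} ‖Dw‖ + ∞ · 𝟙_N`, `N` the (null, Rademacher) set of
non-differentiability points of `w`, so that the pointwise chain-rule bound along every segment holds
without exception, while `∫ H = ∫_{band} ‖Dw‖`.
An INPUT tool for the Lipschitz port of `NU.nu_shrinking`; no NS-regularity statement is touched.
[cite: CaffarelliVasseur2010DeGiorgiSurvey, Lemma 1.4]
-/

set_option linter.dupNamespace false

noncomputable section

open MeasureTheory Set Function Filter Topology Metric Module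
open scoped NNReal ENNReal

namespace Summit.NavierStokesRegularity.NavierStokesRegularity.Theorems.AveragedConeLiouville.NU

open Summit.NavierStokesRegularity.NavierStokesRegularity.Theorems.AxisymmetricKatoGlobal.EulerScaling

/-! ### The one-dimensional crossing lemma for Lipschitz functions -/

/-- **Crossing lemma, absolutely continuous version.** If `g : ℝ → ℝ` is Lipschitz and
`g 0 ≤ k < l ≤ g 1`, then `l - k ≤ ∫_{(0,1) ∩ {k < g < l}} |g'|` with `g' = deriv g` (a.e. defined):
with `t₁` the last time `g ≤ k` and `t₂` the first later time `g ≥ l`, the interval `(t₁, t₂)` lies in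
the band and `l - k ≤ g t₂ - g t₁ = ∫_{t₁}^{t₂} g'` (FTC for absolutely continuous functions). [folklore] -/
theorem ofReal_sub_le_setLIntegral_enorm_deriv_of_lipschitz {g : ℝ → ℝ} {k l : ℝ} {D : ℝ≥0}
    (hkl : k < l) (hg : LipschitzWith D g) (h0 : g 0 ≤ k) (h1 : l ≤ g 1) :
    ENNReal.ofReal (l - k) ≤ ∫⁻ t in Ioo (0 : ℝ) 1 ∩ {t | k < g t ∧ g t < l}, ‖deriv g t‖ₑ := by
  have hgc : Continuous g := hg.continuous
  -- the last time `t₁ ∈ [0, 1]` at which `g ≤ k`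
  obtain ⟨t₁, ⟨ht₁I, ht₁k⟩, ht₁max⟩ : ∃ t₁, IsGreatest (Icc (0 : ℝ) 1 ∩ g ⁻¹' Iic k) t₁ :=
    (isCompact_Icc.inter_right (isClosed_Iic.preimage hgc)).exists_isGreatest
      ⟨0, ⟨le_rfl, zero_le_one⟩, h0⟩
  -- the first time `t₂ ∈ [t₁, 1]` at which `l ≤ g`
  obtain ⟨t₂, ⟨ht₂I, ht₂l⟩, ht₂min⟩ : ∃ t₂, IsLeast (Icc t₁ 1 ∩ g ⁻¹' Ici l) t₂ :=
    (isCompact_Icc.inter_right (isClosed_Ici.preimage hgc)).exists_isLeast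
      ⟨1, ⟨ht₁I.2, le_rfl⟩, h1⟩
  replace ht₁k : g t₁ ≤ k := ht₁k
  replace ht₂l : l ≤ g t₂ := ht₂l
  have h12 : t₁ < t₂ := lt_of_le_of_ne ht₂I.1 fun h => by
    rw [h] at ht₁k
    linarith
  -- on `(t₁, t₂)` the values lie strictly between the levels
  have hband : Ioo t₁ t₂ ⊆ Ioo (0 : ℝ) 1 ∩ {t | k < g t ∧ g t < l} := by
    intro t ht
    have htI : t ∈ Icc (0 : ℝ) 1 := ⟨ht₁I.1.trans ht.1.le, ht.2.le.trans ht₂I.2⟩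
    refine ⟨⟨ht₁I.1.trans_lt ht.1, ht.2.trans_le ht₂I.2⟩, ?_, ?_⟩
    · by_contra hle
      exact (not_le.2 ht.1) (ht₁max ⟨htI, (not_lt.1 hle : g t ≤ k)⟩)
    · by_contra hle
      exact (not_le.2 ht.2) (ht₂min ⟨⟨ht.1.le, htI.2⟩, (not_lt.1 hle : l ≤ g t)⟩)
  -- the fundamental theorem of calculus for the absolutely continuous `g` on `[t₁, t₂]`
  have hftc : ∫ t in t₁..t₂, deriv g t = g t₂ - g t₁ :=
    (hg.lipschitzOnWith (s := uIcc t₁ t₂)).absolutelyContinuousOnInterval.integral_deriv_eq_sub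
  calc ENNReal.ofReal (l - k) ≤ ENNReal.ofReal (∫ t in t₁..t₂, deriv g t) :=
        ENNReal.ofReal_le_ofReal (by rw [hftc]; linarith)
    _ ≤ ‖∫ t in t₁..t₂, deriv g t‖ₑ := Real.ofReal_le_enorm _
    _ = ‖∫ t in Ioc t₁ t₂, deriv g t‖ₑ := by rw [intervalIntegral.integral_of_le h12.le]
    _ ≤ ∫⁻ t in Ioc t₁ t₂, ‖deriv g t‖ₑ := enorm_integral_le_lintegral_enorm _
    _ = ∫⁻ t in Ioo t₁ t₂, ‖deriv g t‖ₑ := setLIntegral_congr Ioo_ae_eq_Ioc.symm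
    _ ≤ ∫⁻ t in Ioo (0 : ℝ) 1 ∩ {t | k < g t ∧ g t < l}, ‖deriv g t‖ₑ := lintegral_mono_set hband

/-! ### The two-point estimate for Lipschitz functions -/

variable {E : Type*} [NormedAddCommGroup E] [NormedSpace ℝ E] [FiniteDimensional ℝ E]
  [MeasurableSpace E] [BorelSpace E]

omit [FiniteDimensional ℝ E] [MeasurableSpace E] [BorelSpace E] in
/-- The segment parametrisation `t ↦ x + t (y - x)` is `‖y - x‖`-Lipschitz. [folklore] -/
theorem lipschitzWith_lineMap_sub (x y : E) :
    LipschitzWith ‖y - x‖₊ (fun t : ℝ => x + t • (y - x)) := by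
  refine LipschitzWith.of_dist_le_mul fun s t => ?_
  rw [dist_eq_norm, dist_eq_norm, add_sub_add_left_eq_sub, ← sub_smul, norm_smul, Real.norm_eq_abs,
    coe_nnnorm, mul_comm]

/-- **De Giorgi's isoperimetric inequality on a ball for LIPSCHITZ functions** (Caffarelli–Vasseur
2010, Lemma 1.4, `L¹`-gradient form): for `w` Lipschitz on the `n`-dimensional space `E` with an
additive Haar measure `μ` and levels `k < l`,
`(l - k) · μ(B ∩ {w ≤ k}) · μ(B ∩ {l ≤ w}) ≤ 2ⁿ⁺¹ R μ(B) ∫_{B ∩ {k < w < l}} ‖Dw‖ dμ`, `B = B(x₀, R)`,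
`fderiv ℝ w` the a.e. derivative; the band is the OPEN one. [cite: CaffarelliVasseur2010DeGiorgiSurvey, Lemma 1.4] -/
theorem deGiorgi_isoperimetric_ball_of_lipschitz (μ : Measure E) [μ.IsAddHaarMeasure] {w : E → ℝ}
    {K : ℝ≥0} (hw : LipschitzWith K w) (x₀ : E) (R : ℝ) {k l : ℝ} (hkl : k < l) :
    ENNReal.ofReal (l - k) * μ (ball x₀ R ∩ {x | w x ≤ k}) * μ (ball x₀ R ∩ {x | l ≤ w x}) ≤
      2 ^ (finrank ℝ E + 1) * ENNReal.ofReal R * μ (ball x₀ R) *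
        ∫⁻ x in ball x₀ R ∩ {x | k < w x ∧ w x < l}, ‖fderiv ℝ w x‖ₑ ∂μ := by
  rcases le_or_gt R 0 with hR | hR
  · simp [Metric.ball_eq_empty.2 hR]
  set n := finrank ℝ E with hn
  set S : Set E := ball x₀ R with hSdef
  set A₀ : Set E := ball x₀ R ∩ {x | w x ≤ k} with hA₀def
  set A₁ : Set E := ball x₀ R ∩ {x | l ≤ w x} with hA₁def
  have hwc : Continuous w := hw.continuous
  have hA₀m : MeasurableSet A₀ :=
    measurableSet_inter_setOf_le_of_continuousOn isOpen_ball hwc.continuousOn k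
  have hA₁m : MeasurableSet A₁ :=
    measurableSet_inter_setOf_ge_of_continuousOn isOpen_ball hwc.continuousOn l
  -- Rademacher's null set
  set N : Set E := {x | ¬DifferentiableAt ℝ w x} with hNdef
  have hNm : MeasurableSet N := (measurableSet_of_differentiableAt ℝ w).compl
  have hNnull : μ N = 0 := by
    have h := hw.ae_differentiableAt (μ := μ)
    rw [ae_iff] at h
    exact h
  -- the transported density `H = 𝟙_{band} ‖Dw‖ + ∞ 𝟙_N`
  have hS'o : IsOpen (S ∩ w ⁻¹' Ioo k l) := hwc.continuousOn.isOpen_inter_preimage isOpen_ball isOpen_Ioo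
  set H : E → ℝ≥0∞ := fun x => (S ∩ w ⁻¹' Ioo k l).indicator (fun x => ‖fderiv ℝ w x‖ₑ) x +
    N.indicator (fun _ => (⊤ : ℝ≥0∞)) x with hH
  have hHm : Measurable H :=
    ((measurable_fderiv ℝ w).enorm.indicator hS'o.measurableSet).add
      (measurable_const.indicator hNm)
  have hHint : ∫⁻ x, H x ∂μ = ∫⁻ x in S ∩ {x | k < w x ∧ w x < l}, ‖fderiv ℝ w x‖ₑ ∂μ := by
    rw [hH, lintegral_add_left ((measurable_fderiv ℝ w).enorm.indicator hS'o.measurableSet),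
      lintegral_indicator hS'o.measurableSet, lintegral_indicator hNm, setLIntegral_const, hNnull,
      mul_zero, add_zero]
    rfl
  -- Step 1: the pointwise estimate along every segment between the two level sets
  have step1 : ∀ x ∈ A₀, ∀ y ∈ A₁,
      ENNReal.ofReal (l - k) ≤
        2 * ENNReal.ofReal R * ∫⁻ t in Ioo (0 : ℝ) 1, H (x + t • (y - x)) := by
    intro x hx y hy
    set γ : ℝ → E := fun t => x + t • (y - x) with hγ
    have hγc : Continuous γ := by fun_prop
    have hγS : ∀ t ∈ Icc (0 : ℝ) 1, γ t ∈ S := fun t ht =>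
      (convex_ball x₀ R).segment_subset hx.1 hy.1
        (by rw [segment_eq_image']; exact mem_image_of_mem _ ht)
    have hγd : ∀ t, HasDerivAt γ (y - x) t := fun t => by
      have h := ((hasDerivAt_id' t).smul_const (y - x)).const_add x
      rwa [one_smul] at h
    set g : ℝ → ℝ := fun t => w (γ t) with hg
    have hgL : LipschitzWith (K * ‖y - x‖₊) g := hw.comp (lipschitzWith_lineMap_sub x y)
    have h0 : g 0 ≤ k := by simpa [hg, hγ] using hx.2
    have h1 : l ≤ g 1 := by simpa [hg, hγ] using hy.2
    have h2R : ‖y - x‖ₑ ≤ 2 * ENNReal.ofReal R :=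
      enorm_sub_le_two_mul_ofReal_of_mem_ball hx.1 hy.1
    have h2R0 : 2 * ENNReal.ofReal R ≠ 0 :=
      mul_ne_zero two_ne_zero (ENNReal.ofReal_pos.2 hR).ne'
    calc ENNReal.ofReal (l - k)
        ≤ ∫⁻ t in Ioo (0 : ℝ) 1 ∩ {t | k < g t ∧ g t < l}, ‖deriv g t‖ₑ :=
          ofReal_sub_le_setLIntegral_enorm_deriv_of_lipschitz hkl hgL h0 h1
      _ ≤ ∫⁻ t in Ioo (0 : ℝ) 1 ∩ {t | k < g t ∧ g t < l}, 2 * ENNReal.ofReal R * H (γ t) := by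
          refine setLIntegral_mono ((hHm.comp hγc.measurable).const_mul _) fun t ht => ?_
          have htS' : γ t ∈ S ∩ w ⁻¹' Ioo k l := ⟨hγS t (Ioo_subset_Icc_self ht.1), ht.2⟩
          by_cases hN : γ t ∈ N
          · have htop : H (γ t) = ⊤ := by
              simp only [hH, indicator_of_mem htS', indicator_of_mem hN, add_top]
            rw [htop, ENNReal.mul_top h2R0]
            exact le_top
          · have hdiff : DifferentiableAt ℝ w (γ t) := not_not.1 hN
            have hgd : HasDerivAt g (fderiv ℝ w (γ t) (y - x)) t :=
              hdiff.hasFDerivAt.comp_hasDerivAt t (hγd t)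
            rw [hgd.deriv]
            have hHge : ‖fderiv ℝ w (γ t)‖ₑ ≤ H (γ t) := by
              simp only [hH, indicator_of_mem htS', indicator_of_notMem hN, add_zero, le_refl]
            calc ‖fderiv ℝ w (γ t) (y - x)‖ₑ ≤ ‖fderiv ℝ w (γ t)‖ₑ * ‖y - x‖ₑ :=
                  ContinuousLinearMap.le_opENorm _ _
              _ ≤ H (γ t) * (2 * ENNReal.ofReal R) := by gcongr
              _ = 2 * ENNReal.ofReal R * H (γ t) := mul_comm _ _
      _ ≤ ∫⁻ t in Ioo (0 : ℝ) 1, 2 * ENNReal.ofReal R * H (γ t) :=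
          lintegral_mono_set inter_subset_left
      _ = 2 * ENNReal.ofReal R * ∫⁻ t in Ioo (0 : ℝ) 1, H (x + t • (y - x)) :=
          lintegral_const_mul _ (hHm.comp hγc.measurable)
  -- the transported integrand on `(E × E) × ℝ`
  set Φ : (E × E) × ℝ → ℝ≥0∞ := fun q => H (q.1.1 + q.2 • (q.1.2 - q.1.1)) with hΦ
  have hΦm : Measurable Φ := by
    refine hHm.comp ?_
    exact (measurable_fst.comp measurable_fst).add
      (measurable_snd.smul ((measurable_snd.comp measurable_fst).sub
        (measurable_fst.comp measurable_fst)))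
  set ν := (μ.restrict A₀).prod (μ.restrict A₁) with hν
  have hA₀B : μ A₀ ≤ μ (ball x₀ R) := measure_mono inter_subset_left
  have hA₁B : μ A₁ ≤ μ (ball x₀ R) := measure_mono inter_subset_left
  -- Step 2: for fixed `t`, the integral over the pairs is at most `2ⁿ μ(B) ∫ H`
  have step2 : ∀ t ∈ Ioo (0 : ℝ) 1, ∫⁻ z, Φ (z, t) ∂ν ≤ 2 ^ n * μ (ball x₀ R) * ∫⁻ x, H x ∂μ := by
    intro t ht
    have hΦt : Measurable fun z : E × E => Φ (z, t) :=
      hΦm.comp (measurable_id.prodMk measurable_const)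
    rcases le_or_gt t (1 / 2) with ht2 | ht2
    · calc ∫⁻ z, Φ (z, t) ∂ν = ∫⁻ y in A₁, ∫⁻ x in A₀, Φ ((x, y), t) ∂μ ∂μ :=
            lintegral_prod_symm _ hΦt.aemeasurable
        _ ≤ ∫⁻ y in A₁, ∫⁻ x, Φ ((x, y), t) ∂μ ∂μ :=
            lintegral_mono fun y => lintegral_mono' Measure.restrict_le_self le_rfl
        _ = ∫⁻ y in A₁, ∫⁻ x, H ((1 - t) • x + t • y) ∂μ ∂μ := by
            congr 1 with y; congr 1 with x
            simp only [hΦ]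
            congr 1
            module
        _ ≤ ∫⁻ y in A₁, 2 ^ n * ∫⁻ x, H x ∂μ ∂μ := by
            refine lintegral_mono fun y => ?_
            exact Literature.Analysis.FunctionSpaces.lintegral_comp_smul_add_le μ hHm
              (by linarith) _
        _ = 2 ^ n * μ A₁ * ∫⁻ x, H x ∂μ := by
            rw [lintegral_const, Measure.restrict_apply_univ]; ring
        _ ≤ 2 ^ n * μ (ball x₀ R) * ∫⁻ x, H x ∂μ := by gcongr
    · calc ∫⁻ z, Φ (z, t) ∂ν = ∫⁻ x in A₀, ∫⁻ y in A₁, Φ ((x, y), t) ∂μ ∂μ :=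
            lintegral_prod _ hΦt.aemeasurable
        _ ≤ ∫⁻ x in A₀, ∫⁻ y, Φ ((x, y), t) ∂μ ∂μ :=
            lintegral_mono fun x => lintegral_mono' Measure.restrict_le_self le_rfl
        _ = ∫⁻ x in A₀, ∫⁻ y, H (t • y + (1 - t) • x) ∂μ ∂μ := by
            congr 1 with x; congr 1 with y
            simp only [hΦ]
            congr 1
            module
        _ ≤ ∫⁻ x in A₀, 2 ^ n * ∫⁻ x, H x ∂μ ∂μ := by
            refine lintegral_mono fun x => ?_
            exact Literature.Analysis.FunctionSpaces.lintegral_comp_smul_add_le μ hHm ht2.le _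
        _ = 2 ^ n * μ A₀ * ∫⁻ x, H x ∂μ := by
            rw [lintegral_const, Measure.restrict_apply_univ]; ring
        _ ≤ 2 ^ n * μ (ball x₀ R) * ∫⁻ x, H x ∂μ := by gcongr
  -- Step 3: integrate Step 1 over `A₀ × A₁`, exchange the integrals, use Step 2
  have hνu : ν univ = μ A₀ * μ A₁ := by
    rw [hν, ← univ_prod_univ, Measure.prod_prod, Measure.restrict_apply_univ,
      Measure.restrict_apply_univ]
  have hmem : ∀ᵐ z ∂ν, z ∈ A₀ ×ˢ A₁ := by
    rw [hν, Measure.prod_restrict]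
    exact ae_restrict_mem (hA₀m.prod hA₁m)
  have hae : ∀ᵐ z ∂ν, ENNReal.ofReal (l - k) ≤
      2 * ENNReal.ofReal R * ∫⁻ t in Ioo (0 : ℝ) 1, Φ (z, t) := by
    filter_upwards [hmem] with z hz
    exact step1 z.1 hz.1 z.2 hz.2
  have h2R : 2 * ENNReal.ofReal R ≠ ∞ := ENNReal.mul_ne_top ENNReal.ofNat_ne_top ENNReal.ofReal_ne_top
  calc ENNReal.ofReal (l - k) * μ A₀ * μ A₁ = ∫⁻ _, ENNReal.ofReal (l - k) ∂ν := by
        rw [lintegral_const, hνu, mul_assoc]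
    _ ≤ ∫⁻ z, 2 * ENNReal.ofReal R * (∫⁻ t in Ioo (0 : ℝ) 1, Φ (z, t)) ∂ν := lintegral_mono_ae hae
    _ = 2 * ENNReal.ofReal R * ∫⁻ z, (∫⁻ t in Ioo (0 : ℝ) 1, Φ (z, t)) ∂ν :=
        lintegral_const_mul' _ _ h2R
    _ = 2 * ENNReal.ofReal R * ∫⁻ t in Ioo (0 : ℝ) 1, ∫⁻ z, Φ (z, t) ∂ν := by
        rw [lintegral_lintegral_swap hΦm.aemeasurable]
    _ ≤ 2 * ENNReal.ofReal R * ∫⁻ _ in Ioo (0 : ℝ) 1, 2 ^ n * μ (ball x₀ R) * ∫⁻ x, H x ∂μ := by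
        gcongr 1
        exact setLIntegral_mono' measurableSet_Ioo fun t ht => step2 t ht
    _ = 2 ^ (n + 1) * ENNReal.ofReal R * μ (ball x₀ R) *
          ∫⁻ x in S ∩ {x | k < w x ∧ w x < l}, ‖fderiv ℝ w x‖ₑ ∂μ := by
        rw [lintegral_const, Measure.restrict_apply_univ, Real.volume_Ioo, sub_zero,
          ENNReal.ofReal_one, mul_one, hHint]
        ring

/-! ### The statements on `ℝ³` with the explicit constant -/

/-- **De Giorgi's isoperimetric inequality on balls of `ℝ³` for globally Lipschitz functions**,
explicit constant `(64π/3) R⁴`. [cite: CaffarelliVasseur2010DeGiorgiSurvey, Lemma 1.4] -/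
theorem deGiorgi_isoperimetric_ball_fin_three_of_lipschitzWith
    {w : EuclideanSpace ℝ (Fin 3) → ℝ} {K : ℝ≥0} (hw : LipschitzWith K w)
    (x₀ : EuclideanSpace ℝ (Fin 3)) (R : ℝ) {k l : ℝ} (hkl : k < l) :
    ENNReal.ofReal (l - k) * volume (ball x₀ R ∩ {x | w x ≤ k}) *
        volume (ball x₀ R ∩ {x | l ≤ w x}) ≤
      ENNReal.ofReal (64 * Real.pi / 3 * R ^ 4) *
        ∫⁻ x in ball x₀ R ∩ {x | k < w x ∧ w x < l}, ‖fderiv ℝ w x‖ₑ := by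
  rcases le_or_gt R 0 with hR | hR
  · simp [Metric.ball_eq_empty.2 hR]
  calc _ ≤ _ := deGiorgi_isoperimetric_ball_of_lipschitz volume hw x₀ R hkl
    _ = _ := by rw [finrank_euclideanSpace_fin, ofReal_deGiorgiConst_fin_three hR.le x₀]

/-- **De Giorgi's isoperimetric inequality on balls of `ℝ³` for functions Lipschitz ON THE BALL**
(the Lipschitz twin of `deGiorgi_isoperimetric_ball_fin_three`, same constant, same open band;
`fderiv ℝ w` the a.e. derivative): for `w` `K`-Lipschitz on `B(x₀, R)` and `k < l`,
`(l - k) · |B ∩ {w ≤ k}| · |B ∩ {l ≤ w}| ≤ (64π/3) R⁴ ∫_{B ∩ {k < w < l}} ‖Dw‖`.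
Reduced to the global case by a McShane extension (`LipschitzOnWith.extend_real`), which has the same
values and the same derivative on the open ball. [cite: CaffarelliVasseur2010DeGiorgiSurvey, Lemma 1.4] -/
theorem deGiorgi_isoperimetric_ball_fin_three_of_lipschitz :
    ∀ (w : EuclideanSpace ℝ (Fin 3) → ℝ) (x₀ : EuclideanSpace ℝ (Fin 3)) (R k l : ℝ) (K : ℝ≥0),
      LipschitzOnWith K w (ball x₀ R) → k < l →
      ENNReal.ofReal (l - k) * volume (ball x₀ R ∩ {x | w x ≤ k}) *
          volume (ball x₀ R ∩ {x | l ≤ w x}) ≤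
        ENNReal.ofReal (64 * Real.pi / 3 * R ^ 4) *
          ∫⁻ x in ball x₀ R ∩ {x | k < w x ∧ w x < l}, ‖fderiv ℝ w x‖ₑ := by
  intro w x₀ R k l K hw hkl
  obtain ⟨g, hg, hEq⟩ := hw.extend_real
  have hS0 : ball x₀ R ∩ {x | w x ≤ k} = ball x₀ R ∩ {x | g x ≤ k} := by
    ext x
    simp only [mem_inter_iff, mem_setOf_eq]
    exact ⟨fun h => ⟨h.1, hEq h.1 ▸ h.2⟩, fun h => ⟨h.1, (hEq h.1).symm ▸ h.2⟩⟩
  have hS1 : ball x₀ R ∩ {x | l ≤ w x} = ball x₀ R ∩ {x | l ≤ g x} := by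
    ext x
    simp only [mem_inter_iff, mem_setOf_eq]
    exact ⟨fun h => ⟨h.1, hEq h.1 ▸ h.2⟩, fun h => ⟨h.1, (hEq h.1).symm ▸ h.2⟩⟩
  have hSb : ball x₀ R ∩ {x | k < w x ∧ w x < l} = ball x₀ R ∩ {x | k < g x ∧ g x < l} := by
    ext x
    simp only [mem_inter_iff, mem_setOf_eq]
    exact ⟨fun h => ⟨h.1, hEq h.1 ▸ h.2⟩, fun h => ⟨h.1, (hEq h.1).symm ▸ h.2⟩⟩
  have hD : ∀ x ∈ ball x₀ R ∩ {x | k < g x ∧ g x < l}, ‖fderiv ℝ w x‖ₑ = ‖fderiv ℝ g x‖ₑ := by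
    intro x hx
    have hev : w =ᶠ[𝓝 x] g :=
      Filter.eventually_of_mem (isOpen_ball.mem_nhds hx.1) fun y hy => hEq hy
    rw [hev.fderiv_eq]
  have hmeas : MeasurableSet (ball x₀ R ∩ {x | k < g x ∧ g x < l}) :=
    (hg.continuous.continuousOn.isOpen_inter_preimage isOpen_ball isOpen_Ioo).measurableSet
  rw [hS0, hS1, hSb, setLIntegral_congr_fun hmeas hD]
  exact deGiorgi_isoperimetric_ball_fin_three_of_lipschitzWith hg x₀ R hkl

end Summit.NavierStokesRegularity.NavierStokesRegularity.Theorems.AveragedConeLiouville.NU
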